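import Literature.MathematicalPhysics.QuantumLattice.HubbardSectorFieldSubstitution
import Literature.MathematicalPhysics.QuantumLattice.GrassmannMonomialDeletion
import HarnessLib

/-!
# The single-scale step in the sectorised `L¹–L^∞` norm of Benfatto–Giuliani–Mastropietro (S1)

Topic `MathematicalPhysics/QuantumLattice`; the model-side assembly, in the vocabulary of `SectorisedKernelNorm.lean`
(definition request D1 of the crux idea `sectorised-scale-induction`), of

* `GrassmannEffectiveActionRepresentation.kernelNorm_kernel_map_effAction_le` (the single-scale renormalisation-group
  step for `V = map f Ṽ`, read through an analysis map `g`),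
* `HubbardSectorFieldSubstitution` (the sector-field substitution `S = sectorSubMatrix β F̃` with
  `map (toLin' S) ψ'_{(x,ℓ)} = psiSector β F̃ c x σ ω`, and the analysis map `E = sectorAnalysisMatrix β F'` whose
  kernels are the sectorised kernels, `hubbardSectorKernelNorm β F' A W ≤ ‖kernel (map (toLin' E) W)‖`).

Here: the **sector preimage** `sectorPreimage β F G` of a Grassmann polynomial `G` of the Hubbard torus — the
polynomial of the auxiliary sector fields presented by the sectorised kernels `ε_x^m W_{m,Ω}(x)` of `G` (BGM 2006,
(2.70): `𝒱^{(h)}` rewritten in terms of the sector fields with the kernels `𝔉_{m,h,Ω} * W`) — and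

* **`map_sectorSub_sectorPreimage`** — IT IS A PREIMAGE: `map (toLin' (sectorSubMatrix β F̃)) (sectorPreimage β F G) = G`
  whenever `F̃_ω F_ω = F_ω` and `Σ_ω F_ω = 1` on every momentum carried by a leg of `G` (Fourier inversion
  `sum_sectorisedKernel_mul_conj_prod`, `ε_x |Λ| = βL²`);
* `kernel_sectorPreimage`, `sectorPreimage_mem_evenPart`, `constPart_sectorPreimage`,
  **`kernelNorm_kernel_sectorPreimage_le`** — its kernels of degree `m + 1` have Salmhofer norm
  `≤ ε_x · hubbardSectorKernelNorm β F univ G` (no factorial: `kernelNorm_kernel_presented_le`);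
* **`kernelNorm_sectorAnalysis_effAction_le`** — THE STEP: for an even `G` without constant part supported where
  `Σ_ω F_ω = 1`, a momentum-space covariance `C` whose sectorised propagators `Sᵀ C S` are charged, in Gram form
  (constant `κ`) and summable (`α`), and an output family `F'` with overlap costs `(cr, cc)` for `E S`, IF
  `θ = eα‖Ṽ‖_h/κ² < 1` THEN `∫ dμ_C e^{-G}` is a unit and
  `‖kernel (map (toLin' E) (effAction C G)) (m+1)‖_{ε_x} ≤ cr cc^m ε_x^m ρ^{-(m+1)} e‖Ṽ‖_h/(1-θ)`, whence
  **`hubbardSectorKernelNorm_effAction_le`**: the same bound for `hubbardSectorKernelNorm β F' A (effAction C G)` and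
  every constraint set `A` (BGM 2006, (2.77)).

Everything is proved; `sectorPreimage` is the only definition; no named facts.  The three analytic inputs (sector
counting in `‖Ṽ‖_h`, the sector-propagator constants `(κ, α)`, the multiplier costs `(cr, cc)`) remain hypotheses,
to be discharged per scale by the `SectorPropagator*` / `HubbardBandSectorCounting*` files.

## Sources

G. Benfatto, A. Giuliani, V. Mastropietro, Ann. Henri Poincaré 7 (2006) 809–898 = arXiv:cond-mat/0507686, §2.5
(2.48), §2.7 (2.66)–(2.73), §2.8 (2.76)–(2.83) [`BenfattoGiulianiMastropietro2006`]; M. Salmhofer, Commun. Math.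
Phys. 194 (1998) 249–295, §4.1 [`Salmhofer1998`].
-/

noncomputable section

namespace Literature.MathematicalPhysics.QuantumLattice

open GrassmannAlgebra Finset Literature.Probability.LatticeModels
open scoped InnerProductSpace

/-! ### Generic: scaling a kernel; label tuples with prescribed spin and charge -/

section Generic

variable {𝕜 : Type*} [RCLike 𝕜] {Γ : Type*} [Fintype Γ] [DecidableEq Γ]

/-- **Scaling a kernel scales its norm**: `‖c K‖ = ‖c‖ ‖K‖` in positive degree. [folklore] -/
theorem kernelNorm_const_mul (ε : ℝ) (m : ℕ) (c : 𝕜) (K : (Fin (m + 1) → Γ) → 𝕜) :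
    kernelNorm ε (m + 1) (fun X => c * K X) = ‖c‖ * kernelNorm ε (m + 1) K := by
  rw [kernelNorm_succ, kernelNorm_succ, Real.mul_iSup_of_nonneg (norm_nonneg c)]
  refine iSup_congr fun p => ?_
  rw [Real.mul_iSup_of_nonneg (norm_nonneg c)]
  refine iSup_congr fun x => ?_
  simp only [norm_mul, ← mul_sum]
  ring

/-- Sums of functions of label tuples `((a_i, σ_i), c_i)_i` vanishing unless every leg has the prescribed spin and
charge reduce to sums over the first components. [folklore] -/
theorem sum_label_tuple_eq {B : Type*} [AddCommMonoid B] {A : Type*} [Fintype A] [DecidableEq A] {m : ℕ}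
    (σ c : Fin m → Fin 2) (g : (Fin m → (A × Fin 2) × Fin 2) → B)
    (hg : ∀ K, (∃ i, ¬((K i).1.2 = σ i ∧ (K i).2 = c i)) → g K = 0) :
    ∑ K, g K = ∑ k : Fin m → A, g (fun i => ((k i, σ i), c i)) := by
  classical
  set emb : (Fin m → A) → (Fin m → (A × Fin 2) × Fin 2) := fun k i => ((k i, σ i), c i) with hemb
  have hinj : Function.Injective emb := fun k k' h => funext fun i => by
    have := congrFun h i
    simp only [hemb, Prod.mk.injEq] at this
    exact this.1.1
  rw [← sum_image (f := g) fun k _ k' _ h => hinj h]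
  symm
  refine sum_subset (subset_univ _) fun K _ hK => hg K ?_
  by_contra hall
  push Not at hall
  refine hK (mem_image.2 ⟨fun i => (K i).1.1, mem_univ _, funext fun i => ?_⟩)
  obtain ⟨h1, h2⟩ := hall i
  simp only [hemb]
  rw [← h1, ← h2]

end Generic

/-! ### The sector preimage -/

section Preimage

variable {L M : ℕ} [NeZero L] {N : ℕ}

/-- **The sector preimage** of a Grassmann polynomial `G` of the Hubbard torus for the multiplier family `F`: the
polynomial of the auxiliary position-space sector fields `ψ'_{(x,((ω,σ),c))}` presented, degree by degree, by the
sectorised kernels `ε_x^m W_{m,Ω}(x)` of `G` (BGM 2006, (2.70): `𝒱^{(h)}(ψ) = Σ ∫dx W̃_{m,Ω}(x) ∏ ψ_{x_i,ω_i}` with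
`W̃ = 𝔉_{m,h,Ω} * W`). [cite: BenfattoGiulianiMastropietro2006, §2.7 (2.70)] -/
def sectorPreimage (β : ℝ) (F : Fin N → FreqMomentum L M → ℂ) (G : HubbardGrassmann L M) :
    GrassmannAlgebra ℂ (SpaceTimeIdx L M × SectorLeg N) :=
  ∑ m ∈ range (Fintype.card (HubbardFieldIdx L M) + 1),
    presented ℂ (fun Y : Fin m → SpaceTimeIdx L M × SectorLeg N =>
      ((imagTimeWeight β M : ℝ) : ℂ) ^ m * sectorisedKernel L M β F G m (fun i => (Y i).2) (fun i => (Y i).1))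

/-- **The kernels of the preimage** are those of its degree-`m` presentation (zero beyond `|Γ|`). [folklore] -/
theorem kernel_sectorPreimage (β : ℝ) (F : Fin N → FreqMomentum L M → ℂ) (G : HubbardGrassmann L M) (m : ℕ)
    (Y : Fin m → SpaceTimeIdx L M × SectorLeg N) :
    kernel ℂ (sectorPreimage β F G) m Y =
      if m ≤ Fintype.card (HubbardFieldIdx L M) then
        kernel ℂ (presented ℂ (fun Y : Fin m → SpaceTimeIdx L M × SectorLeg N =>
          ((imagTimeWeight β M : ℝ) : ℂ) ^ m * sectorisedKernel L M β F G m (fun i => (Y i).2) (fun i => (Y i).1))) m Y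
      else 0 := by
  rw [sectorPreimage, kernel_sum]
  split_ifs with hm
  · rw [sum_eq_single_of_mem m (mem_range.2 (Nat.lt_succ_of_le hm)) fun m' _ hm' => kernel_presented_of_ne ℂ _ Y (Ne.symm hm')]
  · exact sum_eq_zero fun m' hm' => kernel_presented_of_ne ℂ _ Y (by have := mem_range.1 hm'; omega)

/-- **The preimage of an even polynomial is even.** [folklore] -/
theorem sectorPreimage_mem_evenPart (β : ℝ) (F : Fin N → FreqMomentum L M → ℂ) {G : HubbardGrassmann L M}
    (hG : G ∈ evenPart ℂ (HubbardFieldIdx L M)) : sectorPreimage β F G ∈ evenPart ℂ (SpaceTimeIdx L M × SectorLeg N) := by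
  refine Subalgebra.sum_mem _ fun m _ => Submodule.sum_mem _ fun Y _ => ?_
  dsimp only
  rcases Nat.even_or_odd m with hm | hm
  · refine Submodule.smul_mem _ _ ?_
    have h := genProd_mem_evenOdd ℂ Y
    rwa [ZMod.natCast_eq_zero_iff_even.2 hm] at h
  · have h0 : sectorisedKernel L M β F G m (fun i => (Y i).2) (fun i => (Y i).1) = 0 := by
      rw [sectorisedKernel_def]
      exact sum_eq_zero fun k _ => by rw [kernel_eq_zero_of_mem_evenPart_of_odd ℂ hG hm, mul_zero]
    rw [h0, mul_zero, zero_smul]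
    exact Submodule.zero_mem _

/-- **The constant part of the preimage is that of `G`.** [folklore] -/
theorem constPart_sectorPreimage (β : ℝ) (F : Fin N → FreqMomentum L M → ℂ) (G : HubbardGrassmann L M) :
    constPart ℂ (sectorPreimage β F G) = constPart ℂ G := by
  have h := kernel_sectorPreimage β F G 0 Fin.elim0
  rw [kernel_zero, if_pos (Nat.zero_le _), kernel_presented] at h
  rw [h]
  simp [sectorisedKernel_zero_degree]

/-- **The norm of the kernels of the preimage**: in degree `m + 1`,
`‖kernel (sectorPreimage β F G) (m+1)‖_{1} ≤ ε_x · hubbardSectorKernelNorm β F univ G` — no factorial loss.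
[cite: BenfattoGiulianiMastropietro2006, §2.8 (2.76)] -/
theorem kernelNorm_kernel_sectorPreimage_le {β : ℝ} (hβ : 0 ≤ β) (F : Fin N → FreqMomentum L M → ℂ)
    (G : HubbardGrassmann L M) (m : ℕ) :
    kernelNorm 1 (m + 1) (kernel ℂ (sectorPreimage β F G) (m + 1)) ≤
      imagTimeWeight β M * hubbardSectorKernelNorm L M β F (univ : Finset (Fin (m + 1) → SectorLeg N)) G := by
  have hε : 0 ≤ imagTimeWeight β M := imagTimeWeight_nonneg hβ M
  have hN0 : 0 ≤ imagTimeWeight β M * hubbardSectorKernelNorm L M β F (univ : Finset (Fin (m + 1) → SectorLeg N)) G :=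
    mul_nonneg hε (hubbardSectorKernelNorm_nonneg hβ F univ G)
  by_cases hm : m + 1 ≤ Fintype.card (HubbardFieldIdx L M)
  · have hk : kernel ℂ (sectorPreimage β F G) (m + 1) =
        kernel ℂ (presented ℂ (fun Y : Fin (m + 1) → SpaceTimeIdx L M × SectorLeg N =>
          ((imagTimeWeight β M : ℝ) : ℂ) ^ (m + 1) * sectorisedKernel L M β F G (m + 1) (fun i => (Y i).2) (fun i => (Y i).1)))
          (m + 1) := funext fun Y => by rw [kernel_sectorPreimage, if_pos hm]
    rw [hk]
    refine (kernelNorm_kernel_presented_le zero_le_one (m + 1) _).trans ?_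
    rw [kernelNorm_const_mul, norm_pow, Complex.norm_real, Real.norm_of_nonneg hε, pow_succ', mul_assoc,
      ← kernelNorm_eq_pow_mul_kernelNorm_one hε, hubbardSectorKernelNorm_def]
    exact mul_le_mul_of_nonneg_left (kernelNorm_prod_le_sectorisedKernelNorm_univ hε _) hε
  · have hk : kernel ℂ (sectorPreimage β F G) (m + 1) = 0 := funext fun Y => by
      rw [kernel_sectorPreimage, if_neg hm]; rfl
    rw [hk, kernelNorm_zero_kernel]
    exact hN0

variable [NeZero M]

/-- **The sector preimage is a preimage** (BGM 2006, (2.70) with (2.48): `𝒱(ψ) = 𝒱̃(ψ_ω)` when the external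
fields decompose as `ψ̂_k = Σ_ω F_ω(k) ψ̂_k` on the support of the kernels): if `F̃_ω F_ω = F_ω` and `Σ_ω F_ω(k) = 1`
for every momentum `k` carried by a leg of a nonzero kernel of `G`, then
`map (toLin' (sectorSubMatrix β F̃)) (sectorPreimage β F G) = G`. [cite: BenfattoGiulianiMastropietro2006, §2.7 (2.70)] -/
theorem map_sectorSub_sectorPreimage {β : ℝ} (hβ : β ≠ 0) (F Ft : Fin N → FreqMomentum L M → ℂ)
    (hFF : ∀ ω k, Ft ω k * F ω k = F ω k) (G : HubbardGrassmann L M)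
    (hsupp : ∀ (m : ℕ) (K : Fin m → HubbardFieldIdx L M), kernel ℂ G m K ≠ 0 → ∀ i, ∑ ω, F ω (K i).1.1 = 1) :
    ExteriorAlgebra.map (Matrix.toLin' (sectorSubMatrix L M β Ft)) (sectorPreimage β F G) = G := by
  conv_rhs => rw [eq_sum_presented_kernel ℂ G]
  rw [sectorPreimage, map_sum]
  refine sum_congr rfl fun m _ => ?_
  rw [map_presented, LinearMap.toMatrix'_toLin']
  congr 1
  funext K
  -- notation
  set ε : ℝ := imagTimeWeight β M with hεdef
  set a : HubbardFieldIdx L M → SpaceTimeIdx L M × SectorLeg N → ℂ := fun K' Y' => sectorSubMatrix L M β Ft K' Y' with ha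
  have hcard : (ε : ℂ) * (Fintype.card (SpaceTimeIdx L M) : ℂ) / (((β * (L : ℝ) ^ 2 : ℝ)) : ℂ) = 1 := by
    have hβL : ((β * (L : ℝ) ^ 2 : ℝ) : ℂ) ≠ 0 := by
      have hL : (L : ℝ) ≠ 0 := by exact_mod_cast NeZero.ne L
      exact_mod_cast mul_ne_zero hβ (pow_ne_zero 2 hL)
    rw [div_eq_one_iff_eq hβL, hεdef]
    exact_mod_cast imagTimeWeight_mul_card β L M
  -- (1) split the label tuples `Y` into positions and discrete labels, reduce the discrete labels to sector tuples
  have h1 : ∑ Y : Fin m → SpaceTimeIdx L M × SectorLeg N, (∏ i, sectorSubMatrix L M β Ft (K i) (Y i)) *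
        (((ε : ℝ) : ℂ) ^ m * sectorisedKernel L M β F G m (fun i => (Y i).2) (fun i => (Y i).1)) =
      ∑ ω : Fin m → Fin N, ∑ x : Fin m → SpaceTimeIdx L M,
        (∏ i, ((((1 / (β * (L : ℝ) ^ 2) : ℝ) : ℂ) * (Ft (ω i) (K i).1.1 *
          (starRingEnd ℂ) (hubbardPlaneWave L M β (K i).2 (K i).1.1 (x i)))))) *
          (((ε : ℝ) : ℂ) ^ m * sectorisedKernel L M β F G m (fun i => ((ω i, (K i).1.2), (K i).2)) x) := by
    rw [← (Equiv.arrowProdEquivProdArrow (Fin m) (fun _ => SpaceTimeIdx L M) (fun _ => SectorLeg N)).symm.sum_comp,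
      Fintype.sum_prod_type, sum_comm]
    -- now `Σ_ℓ Σ_x`; reduce `ℓ` to `ω`
    rw [sum_label_tuple_eq (fun i => (K i).1.2) (fun i => (K i).2)]
    · refine sum_congr rfl fun ω _ => sum_congr rfl fun x _ => ?_
      simp only [Equiv.arrowProdEquivProdArrow, Equiv.coe_fn_symm_mk, sectorSubMatrix_apply, and_self, if_true]
    · rintro ℓ ⟨i, hi⟩
      refine sum_eq_zero fun x _ => ?_
      rw [prod_eq_zero (mem_univ i) ?_, zero_mul]
      simp only [Equiv.arrowProdEquivProdArrow, Equiv.coe_fn_symm_mk, sectorSubMatrix_apply]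
      rw [if_neg]
      exact fun h => hi ⟨h.1.symm, h.2.symm⟩
  rw [h1]
  -- (2) for fixed sectors, Fourier inversion in the positions
  have h2 : ∀ ω : Fin m → Fin N, ∑ x : Fin m → SpaceTimeIdx L M,
        (∏ i, ((((1 / (β * (L : ℝ) ^ 2) : ℝ) : ℂ) * (Ft (ω i) (K i).1.1 *
          (starRingEnd ℂ) (hubbardPlaneWave L M β (K i).2 (K i).1.1 (x i)))))) *
          (((ε : ℝ) : ℂ) ^ m * sectorisedKernel L M β F G m (fun i => ((ω i, (K i).1.2), (K i).2)) x) =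
      (∏ i, F (ω i) (K i).1.1) * kernel ℂ G m K := by
    intro ω
    have hre : ∀ x : Fin m → SpaceTimeIdx L M,
        (∏ i, ((((1 / (β * (L : ℝ) ^ 2) : ℝ) : ℂ) * (Ft (ω i) (K i).1.1 *
          (starRingEnd ℂ) (hubbardPlaneWave L M β (K i).2 (K i).1.1 (x i)))))) *
          (((ε : ℝ) : ℂ) ^ m * sectorisedKernel L M β F G m (fun i => ((ω i, (K i).1.2), (K i).2)) x) =
        ((((1 / (β * (L : ℝ) ^ 2) : ℝ) : ℂ) ^ m * ((ε : ℝ) : ℂ) ^ m * ∏ i, Ft (ω i) (K i).1.1)) *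
          (sectorisedKernel L M β F G m (fun i => ((ω i, (K i).1.2), (K i).2)) x *
            (starRingEnd ℂ) (∏ i, hubbardPlaneWave L M β (K i).2 (K i).1.1 (x i))) := by
      intro x
      rw [prod_mul_distrib, prod_mul_distrib, prod_const, card_univ, Fintype.card_fin, map_prod]
      ring
    simp_rw [hre]
    rw [← mul_sum]
    have hinv := sum_sectorisedKernel_mul_conj_prod hβ F G m (fun i => ((ω i, (K i).1.2), (K i).2)) (fun i => (K i).1.1)
    simp only at hinv
    rw [hinv]
    have hK : (fun i => (((K i).1.1, (K i).1.2), (K i).2)) = K := funext fun i => by simp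
    rw [hK]
    -- collect the scalars: `(βL²)^{-m} ε^m |Λ|^m = 1`, `F̃ F = F`
    have hprod : (∏ i, Ft (ω i) (K i).1.1) * ∏ i, F (ω i) (K i).1.1 = ∏ i, F (ω i) (K i).1.1 := by
      rw [← prod_mul_distrib]
      exact prod_congr rfl fun i _ => hFF _ _
    calc (((1 / (β * (L : ℝ) ^ 2) : ℝ) : ℂ) ^ m * ((ε : ℝ) : ℂ) ^ m * ∏ i, Ft (ω i) (K i).1.1) *
          ((Fintype.card (SpaceTimeIdx L M) : ℂ) ^ m * (∏ i, F (ω i) (K i).1.1) * kernel ℂ G m K)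
        = ((ε : ℂ) * (Fintype.card (SpaceTimeIdx L M) : ℂ) / (((β * (L : ℝ) ^ 2 : ℝ)) : ℂ)) ^ m *
            (((∏ i, Ft (ω i) (K i).1.1) * ∏ i, F (ω i) (K i).1.1) * kernel ℂ G m K) := by
          push_cast
          ring
      _ = (∏ i, F (ω i) (K i).1.1) * kernel ℂ G m K := by rw [hcard, one_pow, one_mul, hprod]
  simp_rw [h2]
  -- (3) the sector sums: `Σ_ω ∏_i F_{ω_i}(k_i) = ∏_i Σ_ω F_ω(k_i) = 1` on the support
  rw [← sum_mul, sum_prod_apply_eq_prod_sum (fun i ω => F ω (K i).1.1)]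
  by_cases hK0 : kernel ℂ G m K = 0
  · rw [hK0, mul_zero]
  · rw [prod_eq_one fun i _ => hsupp m K hK0 i, one_mul]

end Preimage

/-! ### The single-scale step in the sectorised norm -/

section Step

variable {L M : ℕ} [NeZero L] [NeZero M] {N N' : ℕ}

/-- **The single-scale step in the sectorised representation** (Benfatto–Giuliani–Mastropietro 2006, (2.77) with
(2.70)–(2.71a) and (2.80)–(2.82)).  Data: an even `G` without constant part, input families `F, F̃` with `F̃F = F` and
`Σ_ω F_ω = 1` on the momenta of the legs of `G`; a momentum covariance `C` whose sectorised propagators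
`C' = Sᵀ C S` (`S = sectorSubMatrix β F̃`) are charged (`q`), in Gram form with constant `κ`, with row/column sums
`≤ α`; an output family `F'` with `Σ ‖(E S)(Y'',Y')‖ ≤ cr` over `Y'` and `≤ cc` over `Y''` (`E = sectorAnalysisMatrix β F'`);
a radius `ρ > 0` and `θ = eα‖Ṽ‖_h/κ² < 1`, `Ṽ = sectorPreimage β F G`.  THEN `∫ dμ_C e^{-G}` is a unit and in every
degree `m + 1`: `‖kernel (map (toLin' E) (effAction C G)) (m+1)‖_{ε_x} ≤ cr cc^m ε_x^m ρ^{-(m+1)} e‖Ṽ‖_h/(1-θ)`.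
[cite: BenfattoGiulianiMastropietro2006, (2.77) with (2.71a) and (2.80)-(2.82)] -/
theorem kernelNorm_sectorAnalysis_effAction_le {E : Type*} [NormedAddCommGroup E] [InnerProductSpace ℂ E]
    {β : ℝ} (hβ : 0 < β) (F Ft : Fin N → FreqMomentum L M → ℂ) (hFF : ∀ ω k, Ft ω k * F ω k = F ω k)
    (F' : Fin N' → FreqMomentum L M → ℂ) (G : HubbardGrassmann L M) (hG : G ∈ evenPart ℂ (HubbardFieldIdx L M))
    (hG0 : constPart ℂ G = 0)
    (hsupp : ∀ (m : ℕ) (K : Fin m → HubbardFieldIdx L M), kernel ℂ G m K ≠ 0 → ∀ i, ∑ ω, F ω (K i).1.1 = 1)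
    (C : Matrix (HubbardFieldIdx L M) (HubbardFieldIdx L M) ℂ) (q : SpaceTimeIdx L M × SectorLeg N → Bool)
    (hC : ∀ X Y, q X = q Y → ((sectorSubMatrix L M β Ft).transpose * C * sectorSubMatrix L M β Ft) X Y = 0)
    (fv gv : SpaceTimeIdx L M × SectorLeg N → E) {κ : ℝ} (hκ : 0 < κ) (hf : ∀ X, q X = true → ‖fv X‖ ≤ κ)
    (hg : ∀ Y, q Y = false → ‖gv Y‖ ≤ κ)
    (hGram : ∀ X Y, q X = true → q Y = false →
      contr ℂ ((sectorSubMatrix L M β Ft).transpose * C * sectorSubMatrix L M β Ft) X Y = ⟪fv X, gv Y⟫_ℂ)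
    {α : ℝ} (hα : 0 < α)
    (hrow : ∀ X, ∑ Y, ‖((sectorSubMatrix L M β Ft).transpose * C * sectorSubMatrix L M β Ft) X Y‖ ≤ α)
    (hcol : ∀ Y, ∑ X, ‖((sectorSubMatrix L M β Ft).transpose * C * sectorSubMatrix L M β Ft) X Y‖ ≤ α)
    {ρ : ℝ} (hρ : 0 < ρ)
    (hθ : Real.exp 1 * α * normV (SpaceTimeIdx L M × SectorLeg N) κ ρ
      (fun m' => kernelNorm 1 (2 * m') (kernel ℂ (sectorPreimage β F G) (2 * m'))) / κ ^ 2 < 1)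
    {cr cc : ℝ} (hcr0 : 0 ≤ cr) (hcc0 : 0 ≤ cc)
    (hrow' : ∀ X'', ∑ X', ‖(sectorAnalysisMatrix L M β F' * sectorSubMatrix L M β Ft) X'' X'‖ ≤ cr)
    (hcol' : ∀ X', ∑ X'', ‖(sectorAnalysisMatrix L M β F' * sectorSubMatrix L M β Ft) X'' X'‖ ≤ cc) :
    IsUnit (effPartitionFn ℂ C G) ∧ ∀ m : ℕ,
      kernelNorm (imagTimeWeight β M) (m + 1)
          (kernel ℂ (ExteriorAlgebra.map (Matrix.toLin' (sectorAnalysisMatrix L M β F')) (effAction ℂ C G)) (m + 1)) ≤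
        cr * cc ^ m * imagTimeWeight β M ^ m * (ρ⁻¹ ^ (m + 1) *
          (Real.exp 1 * normV (SpaceTimeIdx L M × SectorLeg N) κ ρ
            (fun m' => kernelNorm 1 (2 * m') (kernel ℂ (sectorPreimage β F G) (2 * m')))) /
            (1 - Real.exp 1 * α * normV (SpaceTimeIdx L M × SectorLeg N) κ ρ
              (fun m' => kernelNorm 1 (2 * m') (kernel ℂ (sectorPreimage β F G) (2 * m'))) / κ ^ 2)) := by
  have hpre := map_sectorSub_sectorPreimage hβ.ne' F Ft hFF G hsupp
  have h := kernelNorm_kernel_map_effAction_le C (Matrix.toLin' (sectorSubMatrix L M β Ft))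
    (Matrix.toLin' (sectorAnalysisMatrix L M β F')) (sectorPreimage β F G) (sectorPreimage_mem_evenPart β F hG)
    (by rw [constPart_sectorPreimage, hG0]) q (by simpa only [LinearMap.toMatrix'_toLin'] using hC) fv gv hκ hf hg
    (by simpa only [LinearMap.toMatrix'_toLin'] using hGram) hα (by simpa only [LinearMap.toMatrix'_toLin'] using hrow)
    (by simpa only [LinearMap.toMatrix'_toLin'] using hcol) hρ hθ hcr0 hcc0
    (by simpa only [LinearMap.toMatrix'_toLin'] using hrow') (by simpa only [LinearMap.toMatrix'_toLin'] using hcol')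
    (imagTimeWeight_nonneg hβ.le M)
  rwa [hpre] at h

/-- **The single-scale step in the sectorised `L¹–L^∞` norm (S1)**: under the hypotheses of
`kernelNorm_sectorAnalysis_effAction_le`, for every degree `m + 1` and every constraint set `A` of output label tuples,
`hubbardSectorKernelNorm β F' A (effAction C G) ≤ cr cc^m ε_x^m ρ^{-(m+1)} e‖Ṽ‖_h/(1-θ)` (BGM 2006, (2.77): the norm of
the new effective potential at one sector and one point fixed). [cite: BenfattoGiulianiMastropietro2006, §2.8 (2.77)] -/
theorem hubbardSectorKernelNorm_effAction_le {E : Type*} [NormedAddCommGroup E] [InnerProductSpace ℂ E]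
    {β : ℝ} (hβ : 0 < β) (F Ft : Fin N → FreqMomentum L M → ℂ) (hFF : ∀ ω k, Ft ω k * F ω k = F ω k)
    (F' : Fin N' → FreqMomentum L M → ℂ) (G : HubbardGrassmann L M) (hG : G ∈ evenPart ℂ (HubbardFieldIdx L M))
    (hG0 : constPart ℂ G = 0)
    (hsupp : ∀ (m : ℕ) (K : Fin m → HubbardFieldIdx L M), kernel ℂ G m K ≠ 0 → ∀ i, ∑ ω, F ω (K i).1.1 = 1)
    (C : Matrix (HubbardFieldIdx L M) (HubbardFieldIdx L M) ℂ) (q : SpaceTimeIdx L M × SectorLeg N → Bool)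
    (hC : ∀ X Y, q X = q Y → ((sectorSubMatrix L M β Ft).transpose * C * sectorSubMatrix L M β Ft) X Y = 0)
    (fv gv : SpaceTimeIdx L M × SectorLeg N → E) {κ : ℝ} (hκ : 0 < κ) (hf : ∀ X, q X = true → ‖fv X‖ ≤ κ)
    (hg : ∀ Y, q Y = false → ‖gv Y‖ ≤ κ)
    (hGram : ∀ X Y, q X = true → q Y = false →
      contr ℂ ((sectorSubMatrix L M β Ft).transpose * C * sectorSubMatrix L M β Ft) X Y = ⟪fv X, gv Y⟫_ℂ)
    {α : ℝ} (hα : 0 < α)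
    (hrow : ∀ X, ∑ Y, ‖((sectorSubMatrix L M β Ft).transpose * C * sectorSubMatrix L M β Ft) X Y‖ ≤ α)
    (hcol : ∀ Y, ∑ X, ‖((sectorSubMatrix L M β Ft).transpose * C * sectorSubMatrix L M β Ft) X Y‖ ≤ α)
    {ρ : ℝ} (hρ : 0 < ρ)
    (hθ : Real.exp 1 * α * normV (SpaceTimeIdx L M × SectorLeg N) κ ρ
      (fun m' => kernelNorm 1 (2 * m') (kernel ℂ (sectorPreimage β F G) (2 * m'))) / κ ^ 2 < 1)
    {cr cc : ℝ} (hcr0 : 0 ≤ cr) (hcc0 : 0 ≤ cc)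
    (hrow' : ∀ X'', ∑ X', ‖(sectorAnalysisMatrix L M β F' * sectorSubMatrix L M β Ft) X'' X'‖ ≤ cr)
    (hcol' : ∀ X', ∑ X'', ‖(sectorAnalysisMatrix L M β F' * sectorSubMatrix L M β Ft) X'' X'‖ ≤ cc)
    (m : ℕ) (A : Finset (Fin (m + 1) → SectorLeg N')) :
    hubbardSectorKernelNorm L M β F' A (effAction ℂ C G) ≤
      cr * cc ^ m * imagTimeWeight β M ^ m * (ρ⁻¹ ^ (m + 1) *
        (Real.exp 1 * normV (SpaceTimeIdx L M × SectorLeg N) κ ρ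
          (fun m' => kernelNorm 1 (2 * m') (kernel ℂ (sectorPreimage β F G) (2 * m')))) /
          (1 - Real.exp 1 * α * normV (SpaceTimeIdx L M × SectorLeg N) κ ρ
            (fun m' => kernelNorm 1 (2 * m') (kernel ℂ (sectorPreimage β F G) (2 * m'))) / κ ^ 2)) :=
  (hubbardSectorKernelNorm_le_kernelNorm_map hβ.le F' A _).trans
    ((kernelNorm_sectorAnalysis_effAction_le hβ F Ft hFF F' G hG hG0 hsupp C q hC fv gv hκ hf hg hGram hα hrow hcol hρ hθ
      hcr0 hcc0 hrow' hcol').2 m)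

/-! ### The input norm in the sectorised currency -/

omit [NeZero L] [NeZero M] in
/-- `normV` is monotone in the kernel norms (nonnegative weights). [folklore] -/
theorem normV_mono {Γ : Type*} [Fintype Γ] {κ ρ : ℝ} (hκ : 0 ≤ κ) (hρ : 0 ≤ ρ) {N₁ N₂ : ℕ → ℝ}
    (h : ∀ m', N₁ m' ≤ N₂ m') : normV Γ κ ρ N₁ ≤ normV Γ κ ρ N₂ :=
  sum_le_sum fun m' _ => mul_le_mul_of_nonneg_left (h m') (by positivity)

omit [NeZero L] [NeZero M] in
/-- The bound `e x/(1 - eαx/κ²)` of the single-scale step is increasing in `x` below the threshold. [folklore] -/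
theorem step_bound_mono {κ α x y : ℝ} (hκ : 0 < κ) (hα : 0 < α) (hx : 0 ≤ x) (hxy : x ≤ y)
    (hy : Real.exp 1 * α * y / κ ^ 2 < 1) :
    Real.exp 1 * x / (1 - Real.exp 1 * α * x / κ ^ 2) ≤ Real.exp 1 * y / (1 - Real.exp 1 * α * y / κ ^ 2) := by
  have hy0 : 0 ≤ y := hx.trans hxy
  have hx1 : Real.exp 1 * α * x / κ ^ 2 ≤ Real.exp 1 * α * y / κ ^ 2 := by gcongr
  have hpos : 0 < 1 - Real.exp 1 * α * y / κ ^ 2 := by linarith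
  exact div_le_div₀ (by positivity) (by gcongr) hpos (by linarith)

omit [NeZero M] in
/-- **The kernels of the sector preimage are controlled by the sectorised norms of `G`**, degree by degree:
`‖kernel (sectorPreimage β F G) (2m')‖_1 ≤ ε_x · hubbardSectorKernelNorm β F univ G` (degree `2m'`; in degree `0`
both sides vanish for `constPart G = 0`). [cite: BenfattoGiulianiMastropietro2006, §2.8 (2.76)] -/
theorem kernelNorm_kernel_sectorPreimage_two_mul_le {β : ℝ} (hβ : 0 ≤ β) (F : Fin N → FreqMomentum L M → ℂ)
    (G : HubbardGrassmann L M) (hG0 : constPart ℂ G = 0) (m' : ℕ) :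
    kernelNorm 1 (2 * m') (kernel ℂ (sectorPreimage β F G) (2 * m')) ≤
      imagTimeWeight β M * hubbardSectorKernelNorm L M β F (univ : Finset (Fin (2 * m') → SectorLeg N)) G := by
  rcases m' with _ | m'
  · rw [Nat.mul_zero, kernelNorm_zero_left, kernel_zero, constPart_sectorPreimage, hG0, norm_zero]
    exact mul_nonneg (imagTimeWeight_nonneg hβ M) (hubbardSectorKernelNorm_nonneg hβ F univ G)
  · rw [show 2 * (m' + 1) = 2 * m' + 1 + 1 by ring]
    exact kernelNorm_kernel_sectorPreimage_le hβ F G _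

/-- **S1 with the input norm in the sectorised currency** (Benfatto–Giuliani–Mastropietro 2006, (2.77)): writing
`N̄(m') = ε_x · hubbardSectorKernelNorm β F univ G` (degree `2m'`; equal to the norm over any constraint set containing
the support of the sectorised kernels, `sectorisedKernelNorm_eq_of_support`) and `‖G‖_h = normV Γ' κ ρ N̄`,
`θ̄ = eα‖G‖_h/κ²`: if `θ̄ < 1` then for every degree `m + 1` and constraint set `A`,
`hubbardSectorKernelNorm β F' A (effAction C G) ≤ cr cc^m ε_x^m ρ^{-(m+1)} e‖G‖_h/(1-θ̄)`.
[cite: BenfattoGiulianiMastropietro2006, §2.8 (2.77)] -/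
theorem hubbardSectorKernelNorm_effAction_le_of_sectorNorm {E : Type*} [NormedAddCommGroup E] [InnerProductSpace ℂ E]
    {β : ℝ} (hβ : 0 < β) (F Ft : Fin N → FreqMomentum L M → ℂ) (hFF : ∀ ω k, Ft ω k * F ω k = F ω k)
    (F' : Fin N' → FreqMomentum L M → ℂ) (G : HubbardGrassmann L M) (hG : G ∈ evenPart ℂ (HubbardFieldIdx L M))
    (hG0 : constPart ℂ G = 0)
    (hsupp : ∀ (m : ℕ) (K : Fin m → HubbardFieldIdx L M), kernel ℂ G m K ≠ 0 → ∀ i, ∑ ω, F ω (K i).1.1 = 1)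
    (C : Matrix (HubbardFieldIdx L M) (HubbardFieldIdx L M) ℂ) (q : SpaceTimeIdx L M × SectorLeg N → Bool)
    (hC : ∀ X Y, q X = q Y → ((sectorSubMatrix L M β Ft).transpose * C * sectorSubMatrix L M β Ft) X Y = 0)
    (fv gv : SpaceTimeIdx L M × SectorLeg N → E) {κ : ℝ} (hκ : 0 < κ) (hf : ∀ X, q X = true → ‖fv X‖ ≤ κ)
    (hg : ∀ Y, q Y = false → ‖gv Y‖ ≤ κ)
    (hGram : ∀ X Y, q X = true → q Y = false →
      contr ℂ ((sectorSubMatrix L M β Ft).transpose * C * sectorSubMatrix L M β Ft) X Y = ⟪fv X, gv Y⟫_ℂ)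
    {α : ℝ} (hα : 0 < α)
    (hrow : ∀ X, ∑ Y, ‖((sectorSubMatrix L M β Ft).transpose * C * sectorSubMatrix L M β Ft) X Y‖ ≤ α)
    (hcol : ∀ Y, ∑ X, ‖((sectorSubMatrix L M β Ft).transpose * C * sectorSubMatrix L M β Ft) X Y‖ ≤ α)
    {ρ : ℝ} (hρ : 0 < ρ)
    (hθ : Real.exp 1 * α * normV (SpaceTimeIdx L M × SectorLeg N) κ ρ
      (fun m' => imagTimeWeight β M *
        hubbardSectorKernelNorm L M β F (univ : Finset (Fin (2 * m') → SectorLeg N)) G) / κ ^ 2 < 1)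
    {cr cc : ℝ} (hcr0 : 0 ≤ cr) (hcc0 : 0 ≤ cc)
    (hrow' : ∀ X'', ∑ X', ‖(sectorAnalysisMatrix L M β F' * sectorSubMatrix L M β Ft) X'' X'‖ ≤ cr)
    (hcol' : ∀ X', ∑ X'', ‖(sectorAnalysisMatrix L M β F' * sectorSubMatrix L M β Ft) X'' X'‖ ≤ cc)
    (m : ℕ) (A : Finset (Fin (m + 1) → SectorLeg N')) :
    IsUnit (effPartitionFn ℂ C G) ∧
      hubbardSectorKernelNorm L M β F' A (effAction ℂ C G) ≤
        cr * cc ^ m * imagTimeWeight β M ^ m * (ρ⁻¹ ^ (m + 1) *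
          (Real.exp 1 * normV (SpaceTimeIdx L M × SectorLeg N) κ ρ
            (fun m' => imagTimeWeight β M *
              hubbardSectorKernelNorm L M β F (univ : Finset (Fin (2 * m') → SectorLeg N)) G)) /
            (1 - Real.exp 1 * α * normV (SpaceTimeIdx L M × SectorLeg N) κ ρ
              (fun m' => imagTimeWeight β M *
                hubbardSectorKernelNorm L M β F (univ : Finset (Fin (2 * m') → SectorLeg N)) G) / κ ^ 2)) := by
  set nV : ℝ := normV (SpaceTimeIdx L M × SectorLeg N) κ ρ
    (fun m' => kernelNorm 1 (2 * m') (kernel ℂ (sectorPreimage β F G) (2 * m'))) with hnV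
  set nVbar : ℝ := normV (SpaceTimeIdx L M × SectorLeg N) κ ρ (fun m' => imagTimeWeight β M *
    hubbardSectorKernelNorm L M β F (univ : Finset (Fin (2 * m') → SectorLeg N)) G) with hnVbar
  have hle : nV ≤ nVbar := normV_mono hκ.le hρ.le fun m' => kernelNorm_kernel_sectorPreimage_two_mul_le hβ.le F G hG0 m'
  have hnV0 : 0 ≤ nV := normV_nonneg hκ.le hρ.le fun m' => kernelNorm_nonneg zero_le_one _ _
  have hθ' : Real.exp 1 * α * nV / κ ^ 2 < 1 := lt_of_le_of_lt (by gcongr) hθ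
  obtain ⟨hunit, hstep⟩ := kernelNorm_sectorAnalysis_effAction_le hβ F Ft hFF F' G hG hG0 hsupp C q hC fv gv hκ hf hg hGram
    hα hrow hcol hρ hθ' hcr0 hcc0 hrow' hcol'
  refine ⟨hunit, (hubbardSectorKernelNorm_le_kernelNorm_map hβ.le F' A _).trans ((hstep m).trans ?_)⟩
  have hB := step_bound_mono hκ hα hnV0 hle hθ
  have hε : 0 ≤ imagTimeWeight β M := imagTimeWeight_nonneg hβ.le M
  calc cr * cc ^ m * imagTimeWeight β M ^ m * (ρ⁻¹ ^ (m + 1) * (Real.exp 1 * nV) / (1 - Real.exp 1 * α * nV / κ ^ 2))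
      = cr * cc ^ m * imagTimeWeight β M ^ m * ρ⁻¹ ^ (m + 1) * (Real.exp 1 * nV / (1 - Real.exp 1 * α * nV / κ ^ 2)) := by
        ring
    _ ≤ cr * cc ^ m * imagTimeWeight β M ^ m * ρ⁻¹ ^ (m + 1) * (Real.exp 1 * nVbar / (1 - Real.exp 1 * α * nVbar / κ ^ 2)) :=
        mul_le_mul_of_nonneg_left hB (by positivity)
    _ = _ := by ring

end Step

end Literature.MathematicalPhysics.QuantumLattice
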